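import Summits.Ventures.PercRepro.Night2StarPairs
import Summits.Ventures.PercRepro.Night2StarCount

/-!
# PercRepro — night-2: the sets `T ∪ B` on a line — coloops, bases and terms (blind cell pub-perc-repro, night-2 gen 1)

If all the points of `G ∖ B` lie on ONE line through two points `a, b` of the basis `B`, then for every `∅ ≠ T ⊆ G ∖ B` the set
`T ∪ B` is a spanning non-basis (`union_mem_SNq`) with exactly the `q − 2` coloops `B ∖ {a, b}` (`mem_coloopsOf_union_of_line`,
`mTr_union_of_line`) and at most `C(|T| + 2, 2)` bases (p3's `bIn_le_choose`), so it pays at least `[q/(q − 1) − Φ]/C(|T| + 2, 2)`,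
and `q/(q − 1)/C(|T| + 2, 2)` when `G ∖ (T ∪ B)` has at most one point (`line_term_ge`). Continued in `Night2StarLineAll`
(Lemma 9 of `proofs/NIGHT-2-star.md`: the pure line satisfies `(★)` for every `q` and every corank).
-/

namespace PercRepro.Star

open Finset ThmH SixFour GenQ

variable {α : Type*} [DecidableEq α] {M : Matroid α} [M.Finite]

/-! ## The sets `T ∪ B` -/

/-- `T ∪ B` is a spanning non-basis for `∅ ≠ T ⊆ G ∖ B`. -/
theorem union_mem_SNq {G B T : Finset α} {q : ℕ} (hrG : M.eRk (G : Set α) = (q : ℕ∞)) (hB : B ∈ Bq M G q)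
    (hT : T ⊆ G \ B) (hne : T.Nonempty) : T ∪ B ∈ SNq M G q ∧ (T ∪ B).card = T.card + q := by
  obtain ⟨hBG, hrB, hBq⟩ := mem_Bq.1 hB
  have hsub : T ∪ B ⊆ G := Finset.union_subset (hT.trans Finset.sdiff_subset) hBG
  have hdisj : Disjoint T B := by
    rw [Finset.disjoint_left]
    intro z hz hzB
    exact (Finset.mem_sdiff.1 (hT hz)).2 hzB
  have hcard : (T ∪ B).card = T.card + q := by rw [Finset.card_union_of_disjoint hdisj, hBq]
  have hr : M.eRk ((T ∪ B : Finset α) : Set α) = (q : ℕ∞) := by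
    apply le_antisymm
    · have := M.eRk_mono (Finset.coe_subset.2 hsub)
      rw [hrG] at this
      exact this
    · have := M.eRk_mono (Finset.coe_subset.2 (Finset.subset_union_right (s₁ := T) (s₂ := B)))
      rw [hrB] at this
      exact this
  refine ⟨mem_SNq.2 ⟨hsub, hr, ?_⟩, hcard⟩
  have := hne.card_pos
  omega

/-- On the line: every `w ∈ B ∖ {a, b}` is a coloop of `T ∪ B`. -/
theorem mem_coloopsOf_union_of_line {G B T : Finset α} {q : ℕ} (hG : G ⊆ gr M) (hB : B ∈ Bq M G q)
    {a b : α} (ha : a ∈ B) (hb : b ∈ B)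
    (hline : ∀ x ∈ G \ B, x ∈ M.closure ({a, b} : Set α)) (hT : T ⊆ G \ B) {w : α} (hw : w ∈ B) (hwa : w ≠ a)
    (hwb : w ≠ b) : w ∈ coloopsOf M (T ∪ B) := by
  rw [mem_coloopsOf]
  refine ⟨Finset.mem_union_right T hw, ?_⟩
  have hwT : w ∉ T := fun h => (Finset.mem_sdiff.1 (hT h)).2 hw
  have hBE : (B : Set α) ⊆ M.E := by
    rw [← coe_gr M]
    exact Finset.coe_subset.2 ((mem_Bq.1 hB).1.trans hG)
  -- `(T ∪ B).erase w ⊆ cl(B.erase w)`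
  have hsub : (((T ∪ B).erase w : Finset α) : Set α) ⊆ M.closure ((B.erase w : Finset α) : Set α) := by
    intro z hz
    rw [Finset.mem_coe, Finset.mem_erase, Finset.mem_union] at hz
    rcases hz.2 with hzT | hzB
    · have h1 := hline z (hT hzT)
      have h2 : ({a, b} : Set α) ⊆ ((B.erase w : Finset α) : Set α) := by
        intro y hy
        rw [Set.mem_insert_iff, Set.mem_singleton_iff] at hy
        rw [Finset.mem_coe, Finset.mem_erase]
        rcases hy with rfl | rfl
        · exact ⟨Ne.symm hwa, ha⟩
        · exact ⟨Ne.symm hwb, hb⟩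
      exact M.closure_subset_closure h2 h1
    · apply M.subset_closure _ (fun y hy => hBE (Finset.mem_coe.1 (Finset.mem_of_mem_erase (Finset.mem_coe.1 hy))))
      rw [Finset.mem_coe, Finset.mem_erase]
      exact ⟨hz.1, hzB⟩
  intro hcl
  have h := M.closure_subset_closure_of_subset_closure hsub hcl
  have hind := indep_of_eRk_eq_of_card_eq (mem_Bq.1 hB).2.1 (mem_Bq.1 hB).2.2
  have := hind.notMem_closure_sdiff_of_mem (Finset.mem_coe.2 hw)
  rw [← Finset.coe_erase] at this
  exact this h

/-- On the line, `T ∪ B` has exactly `q − 2` coloops. -/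
theorem mTr_union_of_line (hs : Simple M) {G B T : Finset α} {q : ℕ} (hG : G ⊆ gr M)
    (hrG : M.eRk (G : Set α) = (q : ℕ∞)) (hB : B ∈ Bq M G q) (hq : 1 ≤ q) {a b : α} (ha : a ∈ B) (hb : b ∈ B)
    (hab : a ≠ b) (hline : ∀ x ∈ G \ B, x ∈ M.closure ({a, b} : Set α)) (hT : T ⊆ G \ B) (hne : T.Nonempty) :
    mTr M (T ∪ B) + 2 = q := by
  obtain ⟨hS, hcard⟩ := union_mem_SNq hrG hB hT hne
  obtain ⟨hSG, hr, -⟩ := mem_SNq.1 hS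
  have hle := mTr_add_two_le_of_spanning_nonbasis hs (hSG.trans hG) hr hq (by have := hne.card_pos; omega)
  have hsub : (B \ {a, b}) ⊆ coloopsOf M (T ∪ B) := by
    intro w hw
    rw [Finset.mem_sdiff, Finset.mem_insert, Finset.mem_singleton, not_or] at hw
    exact mem_coloopsOf_union_of_line hG hB ha hb hline hT hw.1 hw.2.1 hw.2.2
  have hge := Finset.card_le_card hsub
  have hab' : ({a, b} : Finset α) ⊆ B := by
    intro z hz
    rw [Finset.mem_insert, Finset.mem_singleton] at hz
    rcases hz with rfl | rfl
    · exact ha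
    · exact hb
  rw [Finset.card_sdiff_of_subset hab', Finset.card_pair hab, (mem_Bq.1 hB).2.2] at hge
  unfold mTr at hle ⊢
  omega

/-- `2 · C(n, 2) = n(n − 1)`. -/
theorem two_mul_choose_two (n : ℕ) : 2 * n.choose 2 = n * (n - 1) := by
  induction n with
  | zero => simp
  | succ n ih =>
    rw [Nat.choose_succ_succ', Nat.choose_one_right]
    rcases n with _ | n
    · simp
    · rw [Nat.add_sub_cancel] at *
      push_cast at *
      nlinarith [ih]

/-- On the line, `T ∪ B` pays at least `[q/(q − 1) − Φ]/C(|T| + 2, 2)`, and at least `q/(q − 1)/C(|T| + 2, 2)` when `G ∖ (T ∪ B)`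
has at most one point. -/
theorem line_term_ge (hs : Simple M) {G B T : Finset α} {q : ℕ} (hG : G ⊆ gr M)
    (hrG : M.eRk (G : Set α) = (q : ℕ∞)) (hB : B ∈ Bq M G q) (hq : 2 ≤ q) {a b : α} (ha : a ∈ B) (hb : b ∈ B)
    (hab : a ≠ b) (hline : ∀ x ∈ G \ B, x ∈ M.closure ({a, b} : Set α)) (hT : T ⊆ G \ B) (hne : T.Nonempty) :
    ((q : ℚ) / ((q : ℚ) - 1) - ((q : ℚ) + 2) / ((q : ℚ) + 1)) / ((T.card + 2).choose 2 : ℚ) ≤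
        surplus M G q (T ∪ B) / (bIn M G q (T ∪ B) : ℚ) ∧
      (((G \ (T ∪ B)).card ≤ 1) →
        ((q : ℚ) / ((q : ℚ) - 1)) / ((T.card + 2).choose 2 : ℚ) ≤ surplus M G q (T ∪ B) / (bIn M G q (T ∪ B) : ℚ)) := by
  obtain ⟨hS, hcard⟩ := union_mem_SNq hrG hB hT hne
  obtain ⟨hSG, hr, -⟩ := mem_SNq.1 hS
  have hm := mTr_union_of_line hs hG hrG hB (by omega) ha hb hab hline hT hne
  have hbb := bIn_le_choose hG hSG hr
  rw [hcard, show T.card + q - mTr M (T ∪ B) = T.card + 2 by omega, show q - mTr M (T ∪ B) = 2 by omega] at hbb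
  have hbpos := bIn_pos hG hSG hr
  have hb1 : (1 : ℚ) ≤ (bIn M G q (T ∪ B) : ℚ) := by exact_mod_cast hbpos
  have hbq : (bIn M G q (T ∪ B) : ℚ) ≤ ((T.card + 2).choose 2 : ℚ) := by exact_mod_cast hbb
  have hq' : (2 : ℚ) ≤ q := by exact_mod_cast hq
  have hq1 : (0 : ℚ) < (q : ℚ) - 1 := by linarith
  have hq2 : (0 : ℚ) < (q : ℚ) + 1 := by linarith
  have hmq : (mTr M (T ∪ B) : ℚ) + 2 = q := by exact_mod_cast hm
  have hw : wInf M (T ∪ B) = 1 / ((q : ℚ) - 1) := by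
    unfold wInf
    rw [show (1 : ℚ) + (mTr M (T ∪ B) : ℚ) = (q : ℚ) - 1 by linarith]
  have hΦ : ((q : ℚ) + 2) / ((q : ℚ) + 1) ≤ (q : ℚ) / ((q : ℚ) - 1) := by
    rw [div_le_div_iff₀ hq2 hq1]
    nlinarith
  constructor
  · have hsur := surplus_ge_dem (M := M) (G := G) (S := T ∪ B) q
    rw [hw, mul_one_div] at hsur
    exact div_le_div₀ (by linarith) hsur (by linarith) hbq
  · intro hle
    have hnd : ¬ ((2 : ℕ∞) ≤ M.eRk ((G \ (T ∪ B) : Finset α) : Set α)) := by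
      intro h2
      have h := M.eRk_le_encard ((G \ (T ∪ B) : Finset α) : Set α)
      rw [Set.encard_coe_eq_coe_finsetCard] at h
      have h' : (2 : ℕ∞) ≤ ((G \ (T ∪ B)).card : ℕ∞) := h2.trans h
      have h'' : 2 ≤ (G \ (T ∪ B)).card := by exact_mod_cast h'
      omega
    have hsur : surplus M G q (T ∪ B) = (q : ℚ) / ((q : ℚ) - 1) := by
      unfold surplus dem
      rw [if_neg hnd, hw, mul_one_div]
      ring
    rw [hsur]
    exact div_le_div₀ (by positivity) (le_refl _) (by linarith) hbq


end PercRepro.Star
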